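import Literature.Probability.RandomPlanarGeometry.HexSAWStripWidthThreeDensity
import HarnessLib

/-!
# The width-three strip at criticality, concluded: the renewal-point density `ν₃`, the length amplitudes, and the β-walk
# contact law with their constants identified (module «WIDTH-THREE-EXPLICIT»)

Topic `Literature/Probability/RandomPlanarGeometry` (continues «WIDTH-THREE-DENSITY» `HexSAWStripWidthThreeDensity.lean` — the closed
first-moment matrices `W3.cbarThree` / `W3.mbarThree`, the cofactor Perron vectors `W3.uThree` / `W3.ellThree`, `W3.thetaThree`,
`W3.widthThree_contacts_deviation_explicit`).  The density module identified ONE constant (the surface-contact density `θ₃` of long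
bridges); the same uniqueness-of-the-Perron-direction argument identifies every other renewal constant of the critical strip `S₃` that the
lane's generic width-`T` theory produces from a positive fixed pair `(u, ℓ)` of `Iinf T y_T`: here we package the argument once
(`exists_perron_scalars_three`, `ratios_three`) and read off the explicit forms of
«AMPLITUDE-RATIO» #633 `HV.tendsto_stripLenD_residue_explicit` (the simple-pole residues of the length generating functions),
«RENEWAL-POINT-DENSITY» #692 `HV.tendsto_pieces_per_step` and «RENEWAL-POINT-LLN» `HV.tendsto_pieces_deviation` (renewal vertices per step),
«CONTACT-DENSITY-POINTWISE» `HV.tendsto_contacts_per_step_pointwise` (mean contact density), «BETA-CONTACT-DENSITY» `HV.tendsto_beta_contacts_per_step`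
and «BETA-CONTACT-LLN» #770 `HV.tendsto_beta_contacts_deviation` (the β-walks of `S₃`, i.e. the walks of the identity
`1 = c_α A + B + c_ε E` started on the lower boundary).  Lane «pcv-sawmu» (CriticalPhenomena venture), a-p2 g25 — the items listed as
«NOT claimed» in «WIDTH-THREE-DENSITY» (`ν₃` as a theorem, the β-walk analogue).  Sources of the SETTING: W. Feller I (1968) XIII.3 (elementary
renewal theorem), XIII.6, XIII.11 (renewal–reward constants as ratios of first moments); E. Seneta (1973) §1.4 (uniqueness of the positive
eigenvector of an irreducible nonnegative matrix); H. Duminil-Copin, A. Hammond, CMP 324 (2013) §2.2 (bridges, renewal points, irreducible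
bridges); N. R. Beaton, M. Bousquet-Mélou, J. de Gier, H. Duminil-Copin, A. J. Guttmann, CMP 326 (2014) §3.2 and Corollary 8 (the strip
`S_T` at `(x_c, y_T)`).  Nothing below is printed.

## What is proved (namespace `Literature.Probability.RandomPlanarGeometry.SAW.HV.W3`; `x = x_c`, `y₃ = stripYT 3`, `s₃ = sThree`,
## `u₃ = uThree s₃ y₃`, `ℓ₃ = ellThree s₃ y₃`, `M̄₃ = mbarThree y₃`, `C̄₃ = cbarThree y₃`)

* §1 ★ `exists_perron_scalars_three`: every positive fixed pair `(u, ℓ)` of `Iinf 3 y₃` (#633) satisfies `u₃ = t • u`, `ℓ₃ = t' • ℓ` with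
  `t, t' ≠ 0`; the definitions `nuThree := ⟨ℓ₃, u₃⟩/⟨ℓ₃, M̄₃u₃⟩` and `ampThree a b := (u₃)_a (ℓ₃)_b/⟨ℓ₃, M̄₃u₃⟩`; ★ `ratios_three`: for every such
  pair the three generic renewal constants `⟨ℓ, C̄u⟩/⟨ℓ, M̄u⟩`, `⟨ℓ, u⟩/⟨ℓ, M̄u⟩`, `u_aℓ_b/⟨ℓ, M̄u⟩` (with the generic moment matrices as
  `tsum`s) EQUAL `thetaThree`, `nuThree`, `ampThree a b` (scale invariance); `thetaThree_pos`, `nuThree_pos`, `ampThree_pos`.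
* §2 the explicit laws: ★★ `widthThree_stripLenD_residue_explicit : (1 − s)·stripLenD 3 s a b → ampThree a b` as `s ↑ 1` (the length
  generating function of the bridges `a → b` of `S₃` at `(x_c, y₃)` has a simple pole at `s = 1` with the EXPLICIT residue);
  ★★★ `widthThree_pieces_per_step_explicit : (Σ npieces·wD)/(n_k·D̂) → nuThree` and ★★★ `widthThree_pieces_deviation_explicit` — the
  renewal vertices of a long critical bridge of `S₃` concentrate at `ν₃·n`, `ν₃ = nuThree` (numerically `0.8249846784`, `g25/w3/theta3.py`);
  ★★ `widthThree_contacts_per_step_explicit : (Σ #top·wD)/(n_k·D̂) → thetaThree`; ★★ `widthThree_beta_contacts_per_step_explicit` and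
  ★★★ `widthThree_beta_contacts_deviation_explicit` — the surface contacts of a long critical β-walk of `S₃` concentrate at `θ₃·n` with the
  SAME explicit `θ₃ = thetaThree` as the bridges (numerically `0.3303707704`).

Label: LANE THEOREM (own result of lane «pcv-sawmu», a-p2 g25, 2026-08-27).  NOT claimed: decimal enclosures of `nuThree`, `thetaThree`,
`ampThree` proved in Lean (kit numerics only); a CLT; `T ≥ 4`.
-/

noncomputable section

open Finset Filter Topology Matrix Literature.Probability.LatticeModels Literature.Probability.Percolation

namespace Literature.Probability.RandomPlanarGeometry.SAW

namespace HV

namespace W3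

/-! ### §1 The Perron scalars and the three renewal constants of `S₃` in closed form -/

/-- ★ **Uniqueness of the Perron direction at `T = 3`, packaged**: for every positive fixed pair `(u, ℓ)` of the critical kernel
`Iinf 3 y₃` the cofactor vectors of «WIDTH-THREE-DENSITY» are NONZERO multiples: `uThree s₃ y₃ = t • u`, `ellThree s₃ y₃ = t' • ℓ`, `t, t' ≠ 0`
(irreducibility of `Iinf 3 y₃` and of its transpose, `Literature.Analysis.Matrix.exists_eq_smul_of_mulVec_eq`, and `(u₃)₀, (ℓ₃)₀ > 0`).
[cite: Seneta1973, §1.4 (uniqueness of the positive eigenvector); DuminilCopinHammond2013, §2.2; lane «pcv-sawmu» a-p2 g25 — own result] -/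
theorem exists_perron_scalars_three {u ℓ : Fin (2 * 3) → ℝ} (hu0 : ∀ a, 0 < u a) (hℓ0 : ∀ b, 0 < ℓ b)
    (hu : Iinf 3 (stripYT 3) *ᵥ u = u) (hℓ : ℓ ᵥ* Iinf 3 (stripYT 3) = ℓ) :
    ∃ t t' : ℝ, t ≠ 0 ∧ t' ≠ 0 ∧ uThree sThree (stripYT 3) = t • u ∧ ellThree sThree (stripYT 3) = t' • ℓ := by
  have hy0 : 0 ≤ stripYT 3 := (stripYT_pos (by norm_num)).le
  have hq1 := xc_pow_six_mul_stripYT_three_lt_one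
  obtain ⟨hnn, hirr⟩ := Iinf_stripYT_nonneg_irred (T := 3) (by norm_num)
  have hK : Iinf 3 (stripYT 3) = kerThree sThree (stripYT 3) := Iinf_three_eq hy0 hq1
  have hD := detThree_stripYT_three
  have huT : Iinf 3 (stripYT 3) *ᵥ uThree sThree (stripYT 3) = uThree sThree (stripYT 3) := by
    rw [hK]; exact kerThree_mulVec_uThree hD
  have hℓT : ellThree sThree (stripYT 3) ᵥ* Iinf 3 (stripYT 3) = ellThree sThree (stripYT 3) := by
    rw [hK]; exact ellThree_vecMul_kerThree hD
  obtain ⟨t, ht⟩ := Literature.Analysis.Matrix.exists_eq_smul_of_mulVec_eq hnn hirr hu0 hu huT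
  have hirrT : ∀ a b : Fin (2 * 3), ∃ j : ℕ, 0 < ((Iinf 3 (stripYT 3))ᵀ ^ j) a b := fun a b => by
    obtain ⟨j, hj⟩ := hirr b a
    exact ⟨j, by rw [← Matrix.transpose_pow]; exact hj⟩
  obtain ⟨t', ht'⟩ := Literature.Analysis.Matrix.exists_eq_smul_of_mulVec_eq (A := (Iinf 3 (stripYT 3))ᵀ) (fun a b => hnn b a) hirrT hℓ0
    (by rw [Matrix.mulVec_transpose]; exact hℓ) (w := ellThree sThree (stripYT 3)) (by rw [Matrix.mulVec_transpose]; exact hℓT)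
  obtain ⟨hpos, hpos'⟩ := uThree_zero_pos
  refine ⟨t, t', ?_, ?_, ht, ht'⟩
  · intro h0; rw [h0, zero_smul] at ht; rw [ht] at hpos; simp at hpos
  · intro h0; rw [h0, zero_smul] at ht'; rw [ht'] at hpos'; simp at hpos'

/-- ★★ **The renewal-point density of the critical width-three strip, explicitly**: `ν₃ := ⟨ℓ₃, u₃⟩/⟨ℓ₃, M̄₃(y₃) u₃⟩` — the reciprocal of the
mean length of an irreducible piece under the invariant weighting, an explicit algebraic function of `x_c` and `y₃` (numerically `0.8249846784`).
[cite: Feller1968, XIII.3 and XIII.11 (renewal density = 1/mean recurrence time); DuminilCopinHammond2013, §2.2; lane «pcv-sawmu» a-p2 g25 — own result] -/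
def nuThree : ℝ :=
  (ellThree sThree (stripYT 3) ⬝ᵥ uThree sThree (stripYT 3)) /
    (ellThree sThree (stripYT 3) ⬝ᵥ (mbarThree (stripYT 3) *ᵥ uThree sThree (stripYT 3)))

/-- ★ **The length amplitudes of the critical width-three strip, explicitly**: `A₃(a,b) := (u₃)_a (ℓ₃)_b/⟨ℓ₃, M̄₃(y₃) u₃⟩` — the residue at
`s = 1` of the length generating function of the bridges `a → b` (see `widthThree_stripLenD_residue_explicit`).
[cite: Feller1968, XIII.11 (the renewal theorem: limit = 1/mean); DuminilCopinHammond2013, §2.2; lane «pcv-sawmu» a-p2 g25 — own result] -/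
def ampThree (a b : Fin (2 * 3)) : ℝ :=
  uThree sThree (stripYT 3) a * ellThree sThree (stripYT 3) b /
    (ellThree sThree (stripYT 3) ⬝ᵥ (mbarThree (stripYT 3) *ᵥ uThree sThree (stripYT 3)))

/-- ★ **Scale invariance: the generic renewal constants of `S₃` are the explicit ones.**  For every positive fixed pair `(u, ℓ)` of
`Iinf 3 y₃`: `⟨ℓ, C̄u⟩/⟨ℓ, M̄u⟩ = thetaThree`, `⟨ℓ, u⟩/⟨ℓ, M̄u⟩ = nuThree`, `u_a ℓ_b/⟨ℓ, M̄u⟩ = ampThree a b`, where `C̄`, `M̄` are the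
contact / length first-moment matrices written as the generic `tsum`s of the lane's width-`T` theory.
[cite: Feller1968, XIII.11; Seneta1973, §1.4; DuminilCopinHammond2013, §2.2; lane «pcv-sawmu» a-p2 g25 — own result] -/
theorem ratios_three {u ℓ : Fin (2 * 3) → ℝ} (hu0 : ∀ a, 0 < u a) (hℓ0 : ∀ b, 0 < ℓ b)
    (hu : Iinf 3 (stripYT 3) *ᵥ u = u) (hℓ : ℓ ᵥ* Iinf 3 (stripYT 3) = ℓ) :
    (ℓ ⬝ᵥ ((Matrix.of fun c d : Fin (2 * 3) =>
        ∑' n : ℕ, ∑ l ∈ LMset 3 n (n : ℤ) (c : ℕ) (d : ℕ), (topCnt 3 l.tail : ℝ) * wD 3 (stripYT 3) l) *ᵥ u)) /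
        (ℓ ⬝ᵥ ((Matrix.of fun a b : Fin (2 * 3) => ∑' n : ℕ, (n : ℝ) * LMM 3 n (n : ℤ) (stripYT 3) a b) *ᵥ u)) = thetaThree ∧
      (ℓ ⬝ᵥ u) / (ℓ ⬝ᵥ ((Matrix.of fun a b : Fin (2 * 3) => ∑' n : ℕ, (n : ℝ) * LMM 3 n (n : ℤ) (stripYT 3) a b) *ᵥ u)) = nuThree ∧
      ∀ a b : Fin (2 * 3), u a * ℓ b / (ℓ ⬝ᵥ ((Matrix.of fun a b : Fin (2 * 3) =>
          ∑' n : ℕ, (n : ℝ) * LMM 3 n (n : ℤ) (stripYT 3) a b) *ᵥ u)) = ampThree a b := by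
  have hy0 : 0 ≤ stripYT 3 := (stripYT_pos (by norm_num)).le
  have hq1 := xc_pow_six_mul_stripYT_three_lt_one
  obtain ⟨t, t', ht0, ht'0, ht, ht'⟩ := exists_perron_scalars_three hu0 hℓ0 hu hℓ
  have hC := contactMomentMatrix_three_eq hy0 hq1
  have hM := lengthMomentMatrix_three_eq hy0 hq1
  have hden : ℓ ⬝ᵥ (mbarThree (stripYT 3) *ᵥ u) ≠ 0 := by
    have := (tendsto_stripLenD_residue_explicit (T := 3) (by norm_num) hu0 hℓ0 hu hℓ).1
    rw [hM] at this
    exact this.ne'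
  rw [hC, hM]
  refine ⟨?_, ?_, fun a b => ?_⟩
  · rw [thetaThree, ht, ht']
    simp only [Matrix.mulVec_smul, dotProduct_smul, smul_dotProduct, smul_eq_mul]
    field_simp
  · rw [nuThree, ht, ht']
    simp only [Matrix.mulVec_smul, dotProduct_smul, smul_dotProduct, smul_eq_mul]
    field_simp
  · rw [ampThree, ht, ht']
    simp only [Matrix.mulVec_smul, dotProduct_smul, smul_dotProduct, smul_eq_mul, Pi.smul_apply]
    field_simp

/-- `θ₃ > 0`, `ν₃ > 0`, and every amplitude `A₃(a,b) > 0` (positivity of #633's Perron pair, of `⟨ℓ, M̄u⟩`, and of the contact entry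
`C̄₃(y₃)₄₅ = x_c y₃`). [cite: Seneta1973, §1.4; Feller1968, XIII.11; lane «pcv-sawmu» a-p2 g25] -/
theorem thetaThree_nuThree_ampThree_pos : 0 < thetaThree ∧ 0 < nuThree ∧ ∀ a b : Fin (2 * 3), 0 < ampThree a b := by
  have hy0 : 0 < stripYT 3 := stripYT_pos (by norm_num)
  have hq1 := xc_pow_six_mul_stripYT_three_lt_one
  obtain ⟨u, ℓ, hu0, hℓ0, hu, hℓ⟩ := exists_pos_fixed_vectors_Iinf_stripYT (T := 3) (by norm_num)
  obtain ⟨hθ, hν, hA⟩ := ratios_three hu0 hℓ0 hu hℓ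
  have hM := lengthMomentMatrix_three_eq hy0.le hq1
  have hden : 0 < ℓ ⬝ᵥ ((Matrix.of fun a b : Fin (2 * 3) => ∑' n : ℕ, (n : ℝ) * LMM 3 n (n : ℤ) (stripYT 3) a b) *ᵥ u) :=
    (tendsto_stripLenD_residue_explicit (T := 3) (by norm_num) hu0 hℓ0 hu hℓ).1
  refine ⟨?_, ?_, fun a b => ?_⟩
  · rw [← hθ, contactMomentMatrix_three_eq hy0.le hq1]
    refine div_pos ?_ hden
    have hx : 0 < hexCriticalFugacity := hexCriticalFugacity_pos_lt_one.1
    -- all entries of `C̄₃(y₃)` are nonnegative and the slant entry `(4,5) = x_c y₃` is positive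
    have hnn : ∀ i j, 0 ≤ cbarThree (stripYT 3) i j := by
      intro i j
      fin_cases i <;> fin_cases j <;> simp [cbarThree] <;> positivity
    have h45 : cbarThree (stripYT 3) 4 5 = hexCriticalFugacity * stripYT 3 := by simp [cbarThree]
    have hCu : ∀ i, 0 ≤ (cbarThree (stripYT 3) *ᵥ u) i := fun i => by
      simp only [Matrix.mulVec, dotProduct]
      exact Finset.sum_nonneg fun j _ => mul_nonneg (hnn i j) (hu0 j).le
    have h1 : cbarThree (stripYT 3) 4 5 * u 5 ≤ (cbarThree (stripYT 3) *ᵥ u) 4 := by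
      simp only [Matrix.mulVec, dotProduct]
      exact Finset.single_le_sum (f := fun j => cbarThree (stripYT 3) 4 j * u j) (fun j _ => mul_nonneg (hnn 4 j) (hu0 j).le)
        (Finset.mem_univ 5)
    have h2 : ℓ 4 * (cbarThree (stripYT 3) *ᵥ u) 4 ≤ ℓ ⬝ᵥ (cbarThree (stripYT 3) *ᵥ u) := by
      simp only [dotProduct]
      exact Finset.single_le_sum (f := fun i => ℓ i * (cbarThree (stripYT 3) *ᵥ u) i) (fun i _ => mul_nonneg (hℓ0 i).le (hCu i))
        (Finset.mem_univ 4)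
    have h0 : 0 < ℓ 4 * (cbarThree (stripYT 3) 4 5 * u 5) := by
      rw [h45]; exact mul_pos (hℓ0 4) (mul_pos (mul_pos hx hy0) (hu0 5))
    nlinarith [hℓ0 4]
  · rw [← hν]
    exact div_pos (by unfold dotProduct; exact Finset.sum_pos (fun i _ => mul_pos (hℓ0 i) (hu0 i)) Finset.univ_nonempty) hden
  · rw [← hA a b]
    exact div_pos (mul_pos (hu0 a) (hℓ0 b)) hden

/-! ### §2 The renewal laws of the critical width-three strip with explicit constants -/

/-- ★★ **The length amplitudes of `S₃`, explicitly**: for every pair of levels `a, b`, `(1 − s)·D₃(s)_{ab} → A₃(a,b) = ampThree a b` as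
`s ↑ 1`, where `D₃(s)_{ab} = Σ_n s^n Σ_{bridges a→b of S₃ with n steps} x_c^n y₃^{#top}` is the length generating function at `(x_c, y₃)` —
#633's `tendsto_stripLenD_residue_explicit` with the residue identified. [cite: Feller1968, XIII.11 (renewal theorem); DuminilCopinHammond2013, §2.2; BeatonBousquetMelouDeGierDuminilCopinGuttmann2014, Corollary 8; lane «pcv-sawmu» a-p2 g25 — own result] -/
theorem widthThree_stripLenD_residue_explicit (a b : Fin (2 * 3)) :
    Tendsto (fun s : ℝ => (1 - s) * stripLenD 3 s a b) (𝓝[<] 1) (𝓝 (ampThree a b)) := by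
  obtain ⟨u, ℓ, hu0, hℓ0, hu, hℓ⟩ := exists_pos_fixed_vectors_Iinf_stripYT (T := 3) (by norm_num)
  have h := (tendsto_stripLenD_residue_explicit (T := 3) (by norm_num) hu0 hℓ0 hu hℓ).2 a b
  rwa [(ratios_three hu0 hℓ0 hu hℓ).2.2 a b] at h

/-- ★★★ **WIDTH THREE: renewal vertices per step → `ν₃` explicitly.**  Along `n_k = 2k + χ_a − χ_b`, the `wD`-weighted mean number of
irreducible pieces of a bridge `a → b` of `S₃` with `n_k` steps, divided by `n_k`, converges to `nuThree` — #692's `tendsto_pieces_per_step`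
with its constant identified. [cite: Feller1968, XIII.3 (elementary renewal theorem); DuminilCopinHammond2013, §2.2; lane «pcv-sawmu» a-p2 g25 — own result] -/
theorem widthThree_pieces_per_step_explicit (a b : Fin (2 * 3)) :
    Tendsto (fun k : ℕ => (∑ l ∈ LUset 3 (2 * k + 1) (hatLen k a b) (a : ℕ) (b : ℕ), (npieces l : ℝ) * wD 3 (stripYT 3) l) /
        ((hatLen k a b : ℝ) * hatD 3 (stripYT 3) k a b)) atTop (𝓝 nuThree) := by
  obtain ⟨u, ℓ, hu0, hℓ0, hu, hℓ⟩ := exists_pos_fixed_vectors_Iinf_stripYT (T := 3) (by norm_num)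
  have h := tendsto_pieces_per_step (T := 3) (by norm_num) hu0 hℓ0 hu hℓ a b
  rwa [(ratios_three hu0 hℓ0 hu hℓ).2.1] at h

/-- ★★★ **WIDTH THREE: the renewal vertices of a long critical bridge of `S₃` concentrate at `ν₃·n`, explicitly.**  For every pair of levels
`a, b` and every `ε > 0`: `(Σ_{bridges a→b with n_k steps and |npieces/n_k − nuThree| ≥ ε} wD)/D̂(k)_{ab} → 0` — the weak law
`tendsto_pieces_deviation` with its constant identified (companion of `widthThree_contacts_deviation_explicit`).
[cite: Feller1968, XIII.3 and XIII.6; DuminilCopinHammond2013, §2.2; BeatonBousquetMelouDeGierDuminilCopinGuttmann2014, Corollary 8; lane «pcv-sawmu» a-p2 g25 — own result] -/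
theorem widthThree_pieces_deviation_explicit (a b : Fin (2 * 3)) {ε : ℝ} (hε : 0 < ε) :
    Tendsto (fun k : ℕ => (∑ l ∈ (LUset 3 (2 * k + 1) (hatLen k a b) (a : ℕ) (b : ℕ)).filter (fun l =>
          ε ≤ |(npieces l : ℝ) / (hatLen k a b : ℝ) - nuThree|), wD 3 (stripYT 3) l) /
        hatD 3 (stripYT 3) k a b) atTop (𝓝 0) := by
  obtain ⟨u, ℓ, hu0, hℓ0, hu, hℓ⟩ := exists_pos_fixed_vectors_Iinf_stripYT (T := 3) (by norm_num)
  have h := tendsto_pieces_deviation (T := 3) (by norm_num) hu0 hℓ0 hu hℓ a b hε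
  rwa [(ratios_three hu0 hℓ0 hu hℓ).2.1] at h

/-- ★★ **WIDTH THREE: mean contact density → `θ₃` explicitly** (the first-moment companion of `widthThree_contacts_deviation_explicit`):
`(Σ_{bridges a→b, n_k steps} #top·wD)/(n_k·D̂(k)_{ab}) → thetaThree`. [cite: Feller1968, XIII.11; DuminilCopinHammond2013, §2.2; BeatonBousquetMelouDeGierDuminilCopinGuttmann2014, §3.2; lane «pcv-sawmu» a-p2 g25 — own result] -/
theorem widthThree_contacts_per_step_explicit (a b : Fin (2 * 3)) :
    Tendsto (fun k : ℕ => (∑ l ∈ LUset 3 (2 * k + 1) (hatLen k a b) (a : ℕ) (b : ℕ), (topCnt 3 l.tail : ℝ) * wD 3 (stripYT 3) l) /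
        ((hatLen k a b : ℝ) * hatD 3 (stripYT 3) k a b)) atTop (𝓝 thetaThree) := by
  obtain ⟨u, ℓ, hu0, hℓ0, hu, hℓ⟩ := exists_pos_fixed_vectors_Iinf_stripYT (T := 3) (by norm_num)
  have h := tendsto_contacts_per_step_pointwise (T := 3) (by norm_num) hu0 hℓ0 hu hℓ a b
  rwa [(ratios_three hu0 hℓ0 hu hℓ).1] at h

/-- ★★ **WIDTH THREE, β-WALKS: mean contact density → `θ₃` explicitly**: `betaCon 3 (2m) y₃/(2m · betaLenSum 3 (2m) y₃) → thetaThree` — the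
β-walks of `S₃` (from the lower boundary) have the same asymptotic contact density as the bridges. [cite: Feller1968, XIII.11; BeatonBousquetMelouDeGierDuminilCopinGuttmann2014, §3.2 and Corollary 8; DuminilCopinHammond2013, §2.2; lane «pcv-sawmu» a-p2 g25 — own result] -/
theorem widthThree_beta_contacts_per_step_explicit :
    Tendsto (fun m : ℕ => betaCon 3 (2 * m) (stripYT 3) / ((2 * (m : ℝ)) * betaLenSum 3 (2 * m) (stripYT 3))) atTop
      (𝓝 thetaThree) := by
  obtain ⟨u, ℓ, hu0, hℓ0, hu, hℓ⟩ := exists_pos_fixed_vectors_Iinf_stripYT (T := 3) (by norm_num)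
  have h := tendsto_beta_contacts_per_step (T := 3) (by norm_num) hu0 hℓ0 hu hℓ
  rwa [(ratios_three hu0 hℓ0 hu hℓ).1] at h

/-- ★★★ **WIDTH THREE, β-WALKS: the surface contacts of a long critical β-walk of `S₃` concentrate at `θ₃·n`, explicitly.**  For every
`ε > 0`: `(Σ_{β-walks with 2m steps and |#top/(2m) − thetaThree| ≥ ε} x_c^{2m} y₃^{#top})/betaLenSum 3 (2m) y₃ → 0` — #770's
`tendsto_beta_contacts_deviation` (with hC2 from «WIDTH-THREE-CRITICAL») with its constant identified: the SAME `θ₃` as for bridges.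
[cite: Feller1968, XIII.6 and XIII.11; BeatonBousquetMelouDeGierDuminilCopinGuttmann2014, §3.2 and Corollary 8; DuminilCopinHammond2013, §2.2; lane «pcv-sawmu» a-p2 g25 — own result] -/
theorem widthThree_beta_contacts_deviation_explicit {ε : ℝ} (hε : 0 < ε) :
    Tendsto (fun m : ℕ => (∑ l ∈ (betaLen 3 (2 * m) (2 * m)).filter (fun l =>
        ε ≤ |(topCnt 3 l : ℝ) / (2 * (m : ℝ)) - thetaThree|), hexCriticalFugacity ^ l.length * stripYT 3 ^ topCnt 3 l) /
      betaLenSum 3 (2 * m) (stripYT 3)) atTop (𝓝 0) := by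
  obtain ⟨u, ℓ, hu0, hℓ0, hu, hℓ⟩ := exists_pos_fixed_vectors_Iinf_stripYT (T := 3) (by norm_num)
  have h := tendsto_beta_contacts_deviation (T := 3) (by norm_num) hu0 hℓ0 hu hℓ widthThree_summable_contactSqIrr hε
  rwa [(ratios_three hu0 hℓ0 hu hℓ).1] at h

end W3

end HV

end Literature.Probability.RandomPlanarGeometry.SAW
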